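/-
Copyright (c) 2026 the pub-hodgecm-mathlib formalisation cell (harness21).  Prover seat hodgecm-mathlib-K2E5-p17 (g7), Track B «K2-LIT»,
#184♮ = hLiu418 = `stmt-HodgeConjecture-24832`; #42S payer road, organ S1 (local Siegel–Weil spanning), shared row (R-b) «frame bridge tensor datum ↔ block
datum» (LEAD F0P6-plan (g14) BATCH #18 (2); road-map owner K2Liu-p07 (g3) 13:05:32Z (α) (Θ-4); assembler K2Liu-p06 (g4)).  FILE 2 of 2: the section transport.
-/
import Summits.HodgeConjecture.HodgeConjecture.Theorems.K2LiuLocalSWTensorBlockFrame          -- ★ (R-b) FILE 1 (K2E5-p17): the frame `Θ = Ad(P ⊕ P)` (⇒ ★ `swSectionLoc`, `FrameTransport`)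
import Literature.NumberTheory.GelbartRogawski1991.LocalSplittingCMFrameNaturality           -- ★ GR (D): `frameSection_localSplittingDatumCM` (⇒ ★ `LocalDoubledRationalFrameModels`)
import HarnessLib

/-!
# Crux `HLiu418`, organ S1, row (R-b), FILE 2: THE LOCAL SIEGEL–WEIL SECTIONS OF THE BLOCK DATUM ARE THOSE OF THE TENSOR DATUM READ THROUGH THE FRAME —
# `F^{block}_{Φ}(g′) = F^{tensor}_{frameOp Φ}(PD g′ PD⁻¹)` for Kudla's CM splittings, with the movers `frameMp⁻¹ m₀`

Cell `hodgecm-mathlib`, crux item hLiu418 = `stmt-HodgeConjecture-24832`, route of record `HCCMUnconditional`; squad K2 ∕ K2Liu, prover K2E5-p17 (g7).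
THEOREMS ONLY (no `def`, no instance, no notation, no named-fact hypothesis, no `sorry`); lane `--supports stmt-HodgeConjecture-24832 --as helper` (count-neutral).

THE MATHEMATICS ([MoeglinVignerasWaldspurger1987, Chap. 2 II Remarque (3)] transport of structure along an isometry of symplectic spaces; [Kudla1994, §3 Thm. 3.1]
rigidity of `P_Δ`-normalised splittings; [HarrisKudlaSweet1996, §1 (1.11)–(1.16)]; [KudlaRallis1994, §1] the Siegel–Weil section `f_Φ(h) = (ω(h)Φ)(0)`).
For a RATIONAL frame `P` between Gram matrices `T₀ ↦ T₀' = Pᵀ T₀ P` with doubled frame `PD = P ⊕ P`, the tree's ★ `FrameTransport` gives `frameConj_{PD} :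
U(T₀'^𝔻)(F_v) ≃ₜ* U(T₀^𝔻)(F_v)` (`g′ ↦ PD g′ PD⁻¹`), `frameOp_{PD} Φ = Φ ∘ PD⁻¹` on `𝒮(F_v^{2n})`, `frameMp_{PD} : S̃p_ψ(𝕎_{T₀'^𝔻}) ≃* S̃p_ψ(𝕎_{T₀^𝔻})`, and for a section `s`
over `U(T₀^𝔻)` the transported section `frameSection s = frameMp⁻¹ ∘ s ∘ frameConj` with `ω_{frameSection s}(g′) = frameOp⁻¹ ∘ ω_s(PD g′ PD⁻¹) ∘ frameOp`.  Hence for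
the local Siegel–Weil sections ★ `swSectionLoc s m₀ Φ h = (ω(m₀ · s h) Φ)(0)`:
* §1 (ANY section, any rank) **`swSectionLoc_frameSection`**: `swSectionLoc (frameSection s) (frameMp⁻¹ m₀) Φ g′ = swSectionLoc s m₀ (frameOp Φ) (PD g′ PD⁻¹)`, and read
  from the source side **`swSectionLoc_eq_frameSection`** (p07's `Θ := frameConj⁻¹`: `swSectionLoc s m₀ Ψ g = swSectionLoc (frameSection s) (frameMp⁻¹ m₀) (frameOp⁻¹ Ψ) (Θ g)`);
* §2 **`map_proj_frameMp_symm_pd_deltaLagrangian`**: `frameMp_{PD}⁻¹` carries movers of `ℓ_Δ` onto `ℓ_Y` to movers (the `hm₀` slot of ★ F6a∕F6c);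
* §3 (R-b1)+(Θ-4) for KUDLA'S CM SPLITTINGS (★ `localSplittingDatumCM`): by ★ (D) `frameSection_localSplittingDatumCM` (`frameSection_{PD} Σ_{T₀} = Σ_{T₀'}` for `T₀'`
  diagonal — Kudla's rigidity, no non-split hypothesis), **`swSectionLoc_localSplittingDatumCM_finSum`**: for `T₀' = T₁ ⊕ᶠ T₂` diagonal (`finSum_smul_diagonal_eq_diagonal`),
  `swSectionLoc Σ_{T₁ ⊕ᶠ T₂} (frameMp_{PD}⁻¹ m₀) Φ g′ = swSectionLoc Σ_{T₀} m₀ (frameOp_{PD} Φ) (PD g′ PD⁻¹)`.  With ★ FILE 1 (the permutation frame of `𝕍 ⊗ V′`,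
  `Pᵀ · gramR(𝕍 ⊗ V′) · P = T₁ ⊕ᶠ T₂`, (Θ-1) `PD · blkLoc(w_Δ^{T₁}) · PD⁻¹ = w₁ ⊗ 1`, (Θ-2), (Θ-3)) the middle-cell values of ★ F6a∕F6c (block datum) become
  the middle-cell values of the witness sections on the tensor datum of record — the `hf₀off` binder of the three hands (K2Liu-p06's assembly glue).
HONEST LABEL: HC_CM is proved only modulo the 7 printed citations (2 remaining named inputs: hLiu418 = stmt-HodgeConjecture-24832, h413 = stmt-HodgeConjecture-24833) until
rung 0 closes; count-neutral helper, closes no item.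
Search: tree ★ `LocalUnitaryFrameTransport` (`frameSection_apply`, `toRep_frameMp_symm_apply`), ★ `LocalDoubledRationalFrameModels` (`coe_frameOp_symm_apply_zero`,
`map_frameW_pd_deltaLagrangian`, `map_frameW_lagrangianY`, `map_proj_frameMp_pd_deltaLagrangian`), ★ `LocalSplittingCMFrameNaturality` ((D)), ★ `K2LiuLocalSWSectionDefs`
(`swSectionLoc_apply`); dedup `rg "swSectionLoc_frameSection|frameMp_symm_pd"` — none.  One `maxHeartbeats 800000` MEASURED (§1; the `LocalMp` rewrites).
References: [MoeglinVignerasWaldspurger1987] LNM 1291, Chap. 2 I.7, II.1 Rem. (6), II Remarque (3); [Kudla1994] Israel J. Math. 87 (1994), §3 Thm. 3.1;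
[HarrisKudlaSweet1996] J. AMS 9 (1996), §1 (1.11)–(1.16); [KudlaRallis1994] S. Kudla, S. Rallis, Ann. of Math. 140 (1994), §1; [Weil1964] Acta Math. 111, n° 13, n° 34.
-/

set_option autoImplicit false
-- the mandated namespace repeats `HodgeConjecture.HodgeConjecture`
set_option linter.dupNamespace false

noncomputable section

open scoped Matrix Kronecker
open NumberField IsDedekindDomain MeasureTheory Matrix
open Literature.RepresentationTheory.HeisenbergGroup
open Literature.NumberTheory.Automorphic Literature.NumberTheory.Automorphic.UnitaryGroup Literature.NumberTheory.Weil1964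
open Literature.NumberTheory.GaloisRepresentations Literature.RepresentationTheory.HarrisKudlaSweet1996
open Literature.NumberTheory.GelbartRogawski1991 Literature.NumberTheory.GelbartRogawski1991.GRConstruction
open Literature.NumberTheory.GelbartRogawski1991.UnitaryDualPair
open Literature.NumberTheory.GelbartRogawski1991.UnitaryDualPair.LocalSplitting
open Literature.NumberTheory.GelbartRogawski1991.UnitaryDualPair.LocalSplitting.FrameTransport
open Literature.NumberTheory.K2Lit.SiegelDoubled
open Summit.HodgeConjecture.HodgeConjecture.Cruxes.HLiu418.K2LiuLocalSWSectionDefs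

namespace Summit.HodgeConjecture.HodgeConjecture.Cruxes.HLiu418.K2LiuLocalSWTensorBlockTransport

variable (L : Type) [Field L] [NumberField L] [IsCMField L] (v : HeightOneSpectrum (𝓞 (Fp L)))

/-! ## §1 The local Siegel–Weil section under a frame transport of the section (any rank, any frame) -/

set_option maxHeartbeats 800000 in -- MEASURED: the `LocalMp` rewrites (`frameSection_apply`, `map_mul`, `toRep_frameMp_symm_apply`) time out at 400000
/-- **THE LOCAL SIEGEL–WEIL SECTION UNDER A FRAME TRANSPORT OF THE SECTION** (any rank, any rational frame `P`, ANY section `s` over `U(J)(F_v)`, any `m₀`):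
`swSectionLoc (frameSection_P s) (frameMp_P⁻¹ m₀) Φ g′ = swSectionLoc s m₀ (frameOp_P Φ) (P g′ P⁻¹)` — since `ω_{frameSection s}(g′) = frameOp⁻¹ ∘ ω_s(P g′ P⁻¹) ∘ frameOp`
(★ `toRep_frameMp_symm_apply`) and `frameOp⁻¹` fixes the value at `0` (★ `coe_frameOp_symm_apply_zero`).
[cite: MoeglinVignerasWaldspurger1987, Chap. 2 II Remarque (3)] [cite: Weil1964, n° 13, p. 160] [cite: KudlaRallis1994, §1] -/
theorem swSectionLoc_frameSection {Nd : ℕ} {T T' : Matrix (Fin Nd) (Fin Nd) (Fp L)} {J J' : Matrix (Fin Nd) (Fin Nd) L}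
    (hJ : J = T.map (algebraMap (Fp L) L)) (hJ' : J' = T'.map (algebraMap (Fp L) L)) (P : GL (Fin Nd) (Fp L))
    (hP : ((P : Matrix (Fin Nd) (Fin Nd) (Fp L)))ᵀ * T * (P : Matrix (Fin Nd) (Fin Nd) (Fp L)) = T')
    (s : UnitaryGroup.localPi L (IsCMField.complexConj L) Nd J v →* LocalMp (Fp L) Nd T v) (m₀ : LocalMp (Fp L) Nd T v)
    (Φ : SchwartzBruhat (Fin Nd → v.adicCompletion (Fp L))) (g' : UnitaryGroup.localPi L (IsCMField.complexConj L) Nd J' v) :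
    swSectionLoc L v (frameSection (Fp L) L (IsCMField.complexConj L) v Nd hJ hJ' P hP s) ((frameMp (Fp L) v Nd P hP).symm m₀) Φ g' =
      swSectionLoc L v s m₀ (frameOp (Fp L) v Nd P Φ) (frameConj (Fp L) L (IsCMField.complexConj L) v Nd hJ hJ' P hP g') := by
  have h1 : (frameMp (Fp L) v Nd P hP).symm m₀ * frameSection (Fp L) L (IsCMField.complexConj L) v Nd hJ hJ' P hP s g' =
      (frameMp (Fp L) v Nd P hP).symm (m₀ * s (frameConj (Fp L) L (IsCMField.complexConj L) v Nd hJ hJ' P hP g')) := by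
    rw [frameSection_apply]
    exact ((frameMp (Fp L) v Nd P hP).symm.map_mul _ _).symm
  rw [swSectionLoc_apply, swSectionLoc_apply, h1]
  rw [toRep_frameMp_symm_apply]
  exact coe_frameOp_symm_apply_zero (Fp L) v P _

/-- the same read from the source side (p07's `Θ = frameConj⁻¹`): `swSectionLoc s m₀ Ψ g = swSectionLoc (frameSection s) (frameMp⁻¹ m₀) (frameOp⁻¹ Ψ) (Θ g)`.
[cite: MoeglinVignerasWaldspurger1987, Chap. 2 II Remarque (3)] [cite: KudlaRallis1994, §1] -/
theorem swSectionLoc_eq_frameSection {Nd : ℕ} {T T' : Matrix (Fin Nd) (Fin Nd) (Fp L)} {J J' : Matrix (Fin Nd) (Fin Nd) L}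
    (hJ : J = T.map (algebraMap (Fp L) L)) (hJ' : J' = T'.map (algebraMap (Fp L) L)) (P : GL (Fin Nd) (Fp L))
    (hP : ((P : Matrix (Fin Nd) (Fin Nd) (Fp L)))ᵀ * T * (P : Matrix (Fin Nd) (Fin Nd) (Fp L)) = T')
    (s : UnitaryGroup.localPi L (IsCMField.complexConj L) Nd J v →* LocalMp (Fp L) Nd T v) (m₀ : LocalMp (Fp L) Nd T v)
    (Ψ : SchwartzBruhat (Fin Nd → v.adicCompletion (Fp L))) (g : UnitaryGroup.localPi L (IsCMField.complexConj L) Nd J v) :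
    swSectionLoc L v s m₀ Ψ g =
      swSectionLoc L v (frameSection (Fp L) L (IsCMField.complexConj L) v Nd hJ hJ' P hP s) ((frameMp (Fp L) v Nd P hP).symm m₀)
        ((frameOp (Fp L) v Nd P).symm Ψ) ((frameConj (Fp L) L (IsCMField.complexConj L) v Nd hJ hJ' P hP).symm g) := by
  rw [swSectionLoc_frameSection, LinearEquiv.apply_symm_apply, ContinuousMulEquiv.apply_symm_apply]

/-! ## §2 Movers under `frameMp⁻¹` -/

variable {n : ℕ} {T₀ T₀' : Matrix (Fin n) (Fin n) (Fp L)} (P : GL (Fin n) (Fp L))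
  (hP : ((P : Matrix (Fin n) (Fin n) (Fp L)))ᵀ * T₀ * (P : Matrix (Fin n) (Fin n) (Fp L)) = T₀')
  {PD : GL (Fin (n + n)) (Fp L)} (hPD : PD = UnitaryGroup.reindexGL (e₂ n) (UnitaryGroup.blockDiagGL (P, P)))

omit [IsCMField L] in
include hPD in
/-- **`frameMp_{PD}⁻¹` CARRIES MOVERS TO MOVERS** (sibling of ★ `map_proj_frameMp_pd_deltaLagrangian`): if `π(q)` carries `ℓ_Δ` onto `ℓ_Y` in `𝕎^𝔻_{T₀}` then
`π(frameMp_{PD}⁻¹ q) = frameW⁻¹ ∘ π(q) ∘ frameW` does so in `𝕎^𝔻_{T₀'}` (`frameW_{PD}` preserves `ℓ_Δ`, ★ `map_frameW_pd_deltaLagrangian`; every frame preserves `ℓ_Y`,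
★ `map_frameW_lagrangianY`) — so the `m₀′ := frameMp⁻¹ m₀` of `swSectionLoc_localSplittingDatumCM_finSum` is an admissible outer implementer for ★ F6a∕F6c (`hm₀`).
[cite: MoeglinVignerasWaldspurger1987, Chap. 2 II Remarque (3)] [cite: Kudla1994, §3 Thm. 3.1] [cite: HarrisKudlaSweet1996, §1 (1.11)] -/
theorem map_proj_frameMp_symm_pd_deltaLagrangian
    (hDD : ((PD : Matrix (Fin (n + n)) (Fin (n + n)) (Fp L)))ᵀ * gramD (Fp L) n T₀ * (PD : Matrix (Fin (n + n)) (Fin (n + n)) (Fp L)) = gramD (Fp L) n T₀')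
    (q : LocalMp (Fp L) (n + n) (gramD (Fp L) n T₀) v)
    (hq : (deltaLagrangian (Fp L) v n).map (toLin (Fp L) v (MpPsi.proj _ q)) = lagrangianY (Fp L) (n + n) v) :
    (deltaLagrangian (Fp L) v n).map (toLin (Fp L) v (MpPsi.proj _ ((frameMp (Fp L) v (n + n) PD hDD).symm q))) = lagrangianY (Fp L) (n + n) v := by
  have hlin : ((((frameSp (Fp L) v (n + n) PD hDD).symm (MpPsi.proj _ q) : LocalSp (Fp L) (n + n) (gramD (Fp L) n T₀') v) :
      ((Fin (n + n) → v.adicCompletion (Fp L)) × (Fin (n + n) → v.adicCompletion (Fp L))) ≃ₗ[v.adicCompletion (Fp L)] ((Fin (n + n) → v.adicCompletion (Fp L)) × (Fin (n + n) → v.adicCompletion (Fp L)))) :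
        ((Fin (n + n) → v.adicCompletion (Fp L)) × (Fin (n + n) → v.adicCompletion (Fp L))) →ₗ[v.adicCompletion (Fp L)] ((Fin (n + n) → v.adicCompletion (Fp L)) × (Fin (n + n) → v.adicCompletion (Fp L)))) =
      (((frameW (Fp L) v (n + n) PD).symm : ((Fin (n + n) → v.adicCompletion (Fp L)) × (Fin (n + n) → v.adicCompletion (Fp L))) ≃ₗ[v.adicCompletion (Fp L)] ((Fin (n + n) → v.adicCompletion (Fp L)) × (Fin (n + n) → v.adicCompletion (Fp L)))) : ((Fin (n + n) → v.adicCompletion (Fp L)) × (Fin (n + n) → v.adicCompletion (Fp L))) →ₗ[v.adicCompletion (Fp L)] ((Fin (n + n) → v.adicCompletion (Fp L)) × (Fin (n + n) → v.adicCompletion (Fp L)))).comp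
        ((((MpPsi.proj _ q : LocalSp (Fp L) (n + n) (gramD (Fp L) n T₀) v) : ((Fin (n + n) → v.adicCompletion (Fp L)) × (Fin (n + n) → v.adicCompletion (Fp L))) ≃ₗ[v.adicCompletion (Fp L)] ((Fin (n + n) → v.adicCompletion (Fp L)) × (Fin (n + n) → v.adicCompletion (Fp L)))) :
            ((Fin (n + n) → v.adicCompletion (Fp L)) × (Fin (n + n) → v.adicCompletion (Fp L))) →ₗ[v.adicCompletion (Fp L)] ((Fin (n + n) → v.adicCompletion (Fp L)) × (Fin (n + n) → v.adicCompletion (Fp L)))).comp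
          ((frameW (Fp L) v (n + n) PD : ((Fin (n + n) → v.adicCompletion (Fp L)) × (Fin (n + n) → v.adicCompletion (Fp L))) ≃ₗ[v.adicCompletion (Fp L)] ((Fin (n + n) → v.adicCompletion (Fp L)) × (Fin (n + n) → v.adicCompletion (Fp L)))) : ((Fin (n + n) → v.adicCompletion (Fp L)) × (Fin (n + n) → v.adicCompletion (Fp L))) →ₗ[v.adicCompletion (Fp L)] ((Fin (n + n) → v.adicCompletion (Fp L)) × (Fin (n + n) → v.adicCompletion (Fp L))))) := by
    apply LinearMap.ext; intro w
    exact symplecticConj_symm_apply _ _ _ w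
  rw [proj_frameMp_symm]
  dsimp only [LocalSplitting.toLin]
  rw [hlin, Submodule.map_comp, Submodule.map_comp, map_frameW_pd_deltaLagrangian (Fp L) v n P hPD]
  change ((deltaLagrangian (Fp L) v n).map (toLin (Fp L) v (MpPsi.proj _ q))).map _ = _
  rw [hq]
  have h1 := map_frameW_lagrangianY (Fp L) v (N := n + n) PD
  conv_lhs => rw [← h1, ← Submodule.map_comp]
  rw [← LinearEquiv.coe_trans, LinearEquiv.self_trans_symm, LinearEquiv.refl_toLinearMap, Submodule.map_id]

/-! ## §3 Kudla's CM splittings: the block datum's Siegel–Weil sections are the tensor datum's, read through the frame -/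

section CM

variable [MeasurableSpace (v.adicCompletion (Fp L))] [BorelSpace (v.adicCompletion (Fp L))]
  (μ : Measure (v.adicCompletion (Fp L))) [μ.IsAddHaarMeasure]

omit [NumberField L] [IsCMField L] in
/-- `(a · diag d′) ⊕ᶠ (b · diag d′)` is diagonal (the `T₀' = diag t'` slot of ★ `frameSection_localSplittingDatumCM`). [folklore] -/
theorem finSum_smul_diagonal_eq_diagonal {m : ℕ} (a b : Fp L) (d₁ d₂ : Fin m → Fp L) :
    UnitaryGroup.finSum m m (a • Matrix.diagonal d₁) (b • Matrix.diagonal d₂) =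
      Matrix.diagonal (Sum.elim (a • d₁) (b • d₂) ∘ finSumFinEquiv.symm) := by
  rw [UnitaryGroup.finSum, ← Matrix.diagonal_smul, ← Matrix.diagonal_smul, Matrix.fromBlocks_diagonal, Matrix.reindex_apply,
    Matrix.submatrix_diagonal_equiv]

/-- **(R-b1) + (Θ-4) THE SECTION TRANSPORT FOR KUDLA'S CM SPLITTINGS.**  For a rational frame `Pᵀ · T₀ · P = T₁ ⊕ᶠ T₂` from a tensor-type Gram matrix
`T₀` (any symmetric invertible) to a DIAGONAL block datum, the local Siegel–Weil sections of the block datum's CM splitting `Σ_{T₁ ⊕ᶠ T₂}` are those of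
`Σ_{T₀}` read through the frame: `swSectionLoc Σ_{block} (frameMp_{PD}⁻¹ m₀) Φ g′ = swSectionLoc Σ_{T₀} m₀ (frameOp_{PD} Φ) (PD g′ PD⁻¹)` — ★ (D)
`frameSection_localSplittingDatumCM` (`frameSection_{PD} Σ_{T₀} = Σ_{block}`, Kudla's rigidity) + `swSectionLoc_frameSection`.
[cite: Kudla1994, §3 Thm. 3.1] [cite: HarrisKudlaSweet1996, §1 (1.11)–(1.16)] [cite: MoeglinVignerasWaldspurger1987, Chap. 2 II Remarque (3)] -/
theorem swSectionLoc_localSplittingDatumCM_finSum {m : ℕ} (hm : 0 < m + m) {T₀ : Matrix (Fin (m + m)) (Fin (m + m)) (Fp L)}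
    (hT₀ : T₀.IsSymm) (hT₀d : IsUnit T₀.det) {T₁ T₂ : Matrix (Fin m) (Fin m) (Fp L)} (t' : Fin (m + m) → Fp L)
    (hT' : UnitaryGroup.finSum m m T₁ T₂ = Matrix.diagonal t') (hT₀'d : IsUnit (UnitaryGroup.finSum m m T₁ T₂).det)
    (P : GL (Fin (m + m)) (Fp L)) (hP : ((P : Matrix (Fin (m + m)) (Fin (m + m)) (Fp L)))ᵀ * T₀ * (P : Matrix _ _ (Fp L)) = UnitaryGroup.finSum m m T₁ T₂)
    {PD : GL (Fin ((m + m) + (m + m))) (Fp L)} (hPD : PD = UnitaryGroup.reindexGL (e₂ (m + m)) (UnitaryGroup.blockDiagGL (P, P)))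
    {JD JD' : Matrix (Fin ((m + m) + (m + m))) (Fin ((m + m) + (m + m))) L}
    (hJD : JD = (gramD (Fp L) (m + m) T₀).map (algebraMap (Fp L) L))
    (hJD' : JD' = (gramD (Fp L) (m + m) (UnitaryGroup.finSum m m T₁ T₂)).map (algebraMap (Fp L) L))
    (χ : HeckeCharacter L) (hχ : IsSplittingChar L 1 χ)
    (m₀ : LocalMp (Fp L) ((m + m) + (m + m)) (gramD (Fp L) (m + m) T₀) v)
    (Φ : SchwartzBruhat (Fin ((m + m) + (m + m)) → v.adicCompletion (Fp L)))
    (g' : UnitaryGroup.localPi L (IsCMField.complexConj L) ((m + m) + (m + m)) JD' v) :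
    swSectionLoc L v (localSplittingDatumCM L v μ (m + m) (hT' ▸ Matrix.isSymm_diagonal t') hT₀'d hJD' χ hχ).localSplitting
        ((frameMp (Fp L) v ((m + m) + (m + m)) PD (transpose_pd_mul_gramD_mul_pd (Fp L) (m + m) P hP hPD)).symm m₀) Φ g' =
      swSectionLoc L v (localSplittingDatumCM L v μ (m + m) hT₀ hT₀d hJD χ hχ).localSplitting m₀
        (frameOp (Fp L) v ((m + m) + (m + m)) PD Φ)
        (frameConj (Fp L) L (IsCMField.complexConj L) v ((m + m) + (m + m)) hJD hJD' PD (transpose_pd_mul_gramD_mul_pd (Fp L) (m + m) P hP hPD) g') := by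
  rw [← frameSection_localSplittingDatumCM L v μ (m + m) hm t' hT' hT₀ hT₀d (hT' ▸ Matrix.isSymm_diagonal t') hT₀'d P hP hPD hJD hJD' χ hχ]
  exact swSectionLoc_frameSection L v hJD hJD' PD _ _ m₀ Φ g'

end CM

end Summit.HodgeConjecture.HodgeConjecture.Cruxes.HLiu418.K2LiuLocalSWTensorBlockTransport

end
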